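import Summits.FinalStateConjecture.FinalStateConjecture.Theses.EIHFluxBalance
import Summits.FinalStateConjecture.FinalStateConjecture.Theses.PhaseMixingCapture
import Literature.Geometry.Lorentzian.TameGenericityDiagonal
import HarnessLib

/-!
# After E′: the crux `EIHFluxBalance.ModulatedKerrHandoff` (H′, stmt-FinalStateConjecture-17402) ALONE implies the summit,
# and hence the sibling crux `PhaseMixingCapture.WeakCosmicCensorshipTame` (stmt-FinalStateConjecture-17269) — by name

A `--supports` piece for the crux item stmt-FinalStateConjecture-17402 recording in the tree, BY NAME, the
strength of H′ now that the route's second crux E′ (`EIHFluxBalance.InertialRecession`,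
stmt-FinalStateConjecture-17403) is a theorem of the tree
(`…Theorems.EIHFluxBalance.InertialRecessionR13.inertialRecession_proof`, whose type is the body of the route decl
verbatim; the route file imports that module):

* `finalStateConjecture_of_modulatedKerrHandoff` — H′ → `FinalStateConjecture`, the route's deciding theorem
  `Theses.EIHFluxBalance.closes` with its second hypothesis discharged by the landed proof of E′ (the route decl
  `InertialRecession` unfolds definitionally to that theorem's type): the route is reduced to its hypothesis crux,
  and conversely every proof of item 17402 is a proof of the summit;
* `weakCosmicCensorshipTame_of_modulatedKerrHandoff` — H′ → `PhaseMixingCapture.WeakCosmicCensorshipTame`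
  (stmt-FinalStateConjecture-17269: tame-generically an MGHD exists and every MGHD has complete `𝓘⁺`), through the
  summit by monotonicity of tame Christodoulou genericity in the property (the same one-line argument as the landed
  `…Theorems.PhaseMixingCaptureCaptureSufficesC2.tameCensorship_of_finalStateConjecture` and
  `…Theorems.ModulatedKerrHandoff.Negative.isTameGeneric_censored_of_modulatedKerrHandoff`, here concluded by name);
* the two contrapositives, the roads by which a refutation elsewhere propagates to H′.

Consequences made machine-visible for the ledger: item 17402 is at least summit-strength (so it cannot close before
the summit's necessary conjunct 17269 does), and a `¬`-theorem for `FinalStateConjecture` or for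
`WeakCosmicCensorshipTame` refutes `ModulatedKerrHandoff`.  Nothing is credited towards either crux.  This module
imports two Theses files and is therefore never a closing file.

Sources: Christodoulou, CQG 16 (1999) A23, p. A24 (genericity by positive codimension, monotone in the property);
Dafermos–Luk arXiv:1710.01722, §1.2.1 and p. 5 (complete `𝓘⁺` for generic data = weak cosmic censorship,
contained in the final state conjecture).
-/

noncomputable section

-- the doubled `FinalStateConjecture` path component is the summit/problem naming scheme
set_option linter.dupNamespace false
-- registered carrier signature on one line (verbatim-header matching)
set_option linter.style.longLine false

namespace Summit.FinalStateConjecture.FinalStateConjecture.Theorems.EIHFluxBalance.ModulatedKerrHandoffStrength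

open scoped Manifold ContDiff
open Literature.Geometry.Lorentzian Literature.Geometry.Lorentzian.InitialDataSet
open Summit.FinalStateConjecture.FinalStateConjecture.Theses

/-- **H′ alone closes the summit.** With E′ (`EIHFluxBalance.InertialRecession`, stmt-FinalStateConjecture-17403) a
theorem of the tree — the route decl unfolds definitionally to the type of the landed closing theorem
`…Theorems.EIHFluxBalance.InertialRecessionR13.inertialRecession_proof` (line `SketchCleanExcision`, skeleton
r13) — the route's deciding theorem
`Theses.EIHFluxBalance.closes : ModulatedKerrHandoff → InertialRecession → FinalStateConjecture` has its second
hypothesis discharged: the modulated multi-Kerr–Schild handoff for tame-generic admissible data implies the final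
state conjecture as stated (Dafermos–Luk arXiv:1710.01722, Conjecture 1 / §1.2.1). [folklore] -/
theorem finalStateConjecture_of_modulatedKerrHandoff (hH : EIHFluxBalance.ModulatedKerrHandoff) :
    _root_.FinalStateConjecture :=
  EIHFluxBalance.closes hH
    Summit.FinalStateConjecture.FinalStateConjecture.Theorems.EIHFluxBalance.InertialRecessionR13.inertialRecession_proof

/-- Contrapositive of `finalStateConjecture_of_modulatedKerrHandoff`: a refutation of the summit statement refutes
the crux H′. [folklore] -/
theorem not_modulatedKerrHandoff_of_not_finalStateConjecture (h : ¬ _root_.FinalStateConjecture) :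
    ¬ EIHFluxBalance.ModulatedKerrHandoff :=
  fun hH ↦ h (finalStateConjecture_of_modulatedKerrHandoff hH)

/-- **H′ contains tame weak cosmic censorship, by name.** `EIHFluxBalance.ModulatedKerrHandoff` implies the
sibling crux `PhaseMixingCapture.WeakCosmicCensorshipTame` (stmt-FinalStateConjecture-17269: tame-generically in the
admissible class an MGHD exists and every MGHD has complete `𝓘⁺`): through the summit
(`finalStateConjecture_of_modulatedKerrHandoff`) and monotonicity of tame Christodoulou genericity in the property
(`IsTameChristodoulouGeneric.mono`) — keep the MGHD-existence conjunct and the first conjunct of the settled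
clause, drop the decomposition. Christodoulou, CQG 16 (1999) A23, p. A24; Dafermos–Luk arXiv:1710.01722, p. 5.
[cite: Christodoulou1999, p. A24] -/
theorem weakCosmicCensorshipTame_of_modulatedKerrHandoff : Summit.FinalStateConjecture.FinalStateConjecture.Theses.EIHFluxBalance.ModulatedKerrHandoff → Summit.FinalStateConjecture.FinalStateConjecture.Theses.PhaseMixingCapture.WeakCosmicCensorshipTame := by
  intro hH X _ _ _ _ _ _
  exact (finalStateConjecture_of_modulatedKerrHandoff hH X).mono
    fun D _ hP ↦ ⟨hP.1, fun 𝒟 h𝒟 ↦ (hP.2 𝒟 h𝒟).1⟩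

/-- Contrapositive of `weakCosmicCensorshipTame_of_modulatedKerrHandoff`: a refutation of the sibling crux
`PhaseMixingCapture.WeakCosmicCensorshipTame` (stmt-FinalStateConjecture-17269) refutes H′. [folklore] -/
theorem not_modulatedKerrHandoff_of_not_weakCosmicCensorshipTame
    (h : ¬ PhaseMixingCapture.WeakCosmicCensorshipTame) : ¬ EIHFluxBalance.ModulatedKerrHandoff :=
  fun hH ↦ h (weakCosmicCensorshipTame_of_modulatedKerrHandoff hH)

end Summit.FinalStateConjecture.FinalStateConjecture.Theorems.EIHFluxBalance.ModulatedKerrHandoffStrength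

end
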